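/-
Copyright (c) 2026 the pub-hodgecm-mathlib formalisation cell (harness21).  Prover seat hodgecm-mathlib-K2E5-p01 (g4) (free E5 hand, cross-unit), HCML Track B «K2-LIT»,
h413 = `stmt-HodgeConjecture-24833`, line `K2_E3_EllipticInputs`, unit U12, socket #11 road (SC-an), road «FC» ((SC-an) line lead K2E3-p14 (g4) RULINGS #16 (R16-4)),
brick (FC-H) «STRONG HENSEL».  §1 is the proof of Mathlib's `IsAdicComplete.henselianRing` (Johan Commelin, 2021) with the unused `Monic` binder removed.  2026-09-04.
-/
import Mathlib.RingTheory.Henselian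
import Mathlib.NumberTheory.LocalField.Basic
import Literature.NumberTheory.GaloisRepresentations.LocalField      -- ★ `normAbs`, `normAbs_le_one_iff`, `normAbs_lt_one_iff_mem_maximalIdeal`
import HarnessLib

/-!
# K2 · E3 · (SC-an) road «FC», brick (FC-H): STRONG HENSEL — a root `a` of `f` with `|a − a₀|·|f′(a₀)| ≤ |f(a₀)|` as soon as `|f(a₀)| < |f′(a₀)|²`, ANY degree,
# no monicity

Cell `pub/hodgecm-mathlib`, crux H413 = `stmt-HodgeConjecture-24833` (lane `--supports … --as helper`, count-neutral); (SC-an) line lead K2E3-p14 (g4) (RULINGS #16 (R16-4):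
«ONE MORE GENERIC BRICK — (FC-H) STRONG HENSEL … ANY degree, NOT assuming `Monic` … Mathlib's `IsAdicComplete.henselianRing` PROOF never uses `Monic` … then the substitution
`f(a₀ + h·t) = h²·F(t)`»), dealer K2E3-plan (g3).  THEOREMS ONLY (no `def` ∕ `instance` ∕ `notation` ∕ named fact ∕ `sorry`).  Consumer: (FC-6a)
`K2E3NearTriangularEigenvalues` (three `K`-rational eigenvalues of a near-triangular `3 × 3` matrix) and the lead's (FC-6b).

THE MATHEMATICS ([NeukirchANT1999, Ch. II (4.6)], [Lang2002, XII §7 Prop. 7.6]).  `R` a commutative ring complete and separated for the `I`-adic topology.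
§1 (NEWTON, Mathlib's proof verbatim minus `Monic`): `f(a₀) ∈ I`, `f′(a₀)` a unit mod `I` ⟹ a root `a ≡ a₀ (mod I)`.  §2 (STRONG FORM): if `f(a₀) = f′(a₀)² · ε` with `ε ∈ I`,
write `h := f′(a₀)` and Taylor-expand `f(a₀ + h t) = h²ε + h·h t + Σ_{k≥2} c_k h^k t^k = h² · F(t)`, `F = ε + t + t² · q(h t)` (`q = ((taylor a₀ f).divX).divX`); `F(0) = ε ∈ I`,
`F′(0) = 1`, so §1 gives a root `t⋆ ∈ I` of `F`, i.e. a root `a = a₀ + h t⋆` of `f`; and `t⋆ (1 + t⋆ q(h t⋆)) = −ε` with `1 + t⋆ q(h t⋆)` a unit (`I ⊆` Jacobson radical) shows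
`t⋆ R = ε R` — the sharp error term.  §3 (LOCAL FIELDS): for `K` non-archimedean local, `R = 𝒪[K]`, `I = 𝓂[K]` (Mathlib `IsAdicComplete 𝓂[K] 𝒪[K]`): `|f(a₀)| < |f′(a₀)|²`
⟹ a root `a ∈ 𝒪[K]` with `|a − a₀| · |f′(a₀)| ≤ |f(a₀)|` (`|·| = normAbs K`), the form (R16-4) asked for.
* §1 `exists_isRoot_sub_mem_of_isAdicComplete`;  §2 `taylor_eval_mul_eq`, **`exists_isRoot_add_mul_of_eval_eq_sq_mul`**;  §3 **`exists_isRoot_of_normAbs_eval_lt_sq`**.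

HONEST LABEL: HC_CM is proved only modulo the 7 printed citations (2 remaining named inputs: hLiu418 = `stmt-HodgeConjecture-24832`, h413 = `stmt-HodgeConjecture-24833`)
until rung 0 closes; count-neutral helper (generic commutative algebra; brick (FC-H) of road «FC»; (SC-an) is NOT ★).

## References
* [NeukirchANT1999] J. Neukirch, *Algebraic Number Theory* (1999), Ch. II §4 Lemma (4.6) (Hensel's lemma in the form `|f(a₀)| < |f′(a₀)|²`).
* [Lang2002] S. Lang, *Algebra*, 3rd ed. (2002), Ch. XII §7 Prop. 7.6 (Newton approximation in complete rings).
-/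

set_option autoImplicit false
-- the mandated namespace has the single-problem summit's repeated segment (`HodgeConjecture.HodgeConjecture`)
set_option linter.dupNamespace false

noncomputable section

open Polynomial

namespace Summit.HodgeConjecture.HodgeConjecture.Cruxes.H413.K2E3StrongHensel

/-! ## §1 Newton's lemma in an adically complete ring, without monicity (Mathlib's proof of `IsAdicComplete.henselianRing`) -/

section Newton

variable {R : Type*} [CommRing R] (I : Ideal R) [IsAdicComplete I R]

/-- **NEWTON'S LEMMA, ANY POLYNOMIAL**: in a ring complete and separated for the `I`-adic topology, a polynomial `f` (NOT assumed monic) with `f(a₀) ∈ I` and `f′(a₀)` a unit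
modulo `I` has a root `a` with `a − a₀ ∈ I`.  The proof is Mathlib's `IsAdicComplete.henselianRing` (Newton iteration `b ↦ b − f(b)·f′(b)⁻¹`), whose `Monic` binder is unused.
[cite: Lang2002, Ch. XII §7 Prop. 7.6] [cite: NeukirchANT1999, Ch. II §4 (4.6)] -/
theorem exists_isRoot_sub_mem_of_isAdicComplete (f : R[X]) (a₀ : R) (h₁ : f.eval a₀ ∈ I)
    (h₂ : IsUnit (Ideal.Quotient.mk I (f.derivative.eval a₀))) : ∃ a : R, f.IsRoot a ∧ a - a₀ ∈ I := by
  classical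
  let f' := derivative f
  -- Newton's sequence
  let c : ℕ → R := fun n => Nat.recOn n a₀ fun _ b => b - f.eval b * Ring.inverse (f'.eval b)
  have hc : ∀ n, c (n + 1) = c n - f.eval (c n) * Ring.inverse (f'.eval (c n)) := by
    intro n
    simp only [c]
  have hc_mod : ∀ n, c n ≡ a₀ [SMOD I] := by
    intro n
    induction n with
    | zero => rfl
    | succ n ih => ?_
    rw [hc, sub_eq_add_neg, ← add_zero a₀]
    refine ih.add ?_
    rw [SModEq.zero, Ideal.neg_mem_iff]
    refine I.mul_mem_right _ ?_
    rw [← SModEq.zero] at h₁ ⊢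
    exact (ih.eval f).trans h₁
  have hf'c : ∀ n, IsUnit (f'.eval (c n)) := by
    intro n
    haveI := isLocalHom_of_le_jacobson_bot I (IsAdicComplete.le_jacobson_bot I)
    apply IsUnit.of_map (Ideal.Quotient.mk I)
    convert h₂ using 1
    exact SModEq.def.mp ((hc_mod n).eval _)
  have hfcI : ∀ n, f.eval (c n) ∈ I ^ (n + 1) := by
    intro n
    induction n with
    | zero => change f.eval a₀ ∈ I ^ (0 + 1); rw [zero_add, pow_one]; exact h₁
    | succ n ih => ?_
    rw [← taylor_eval_sub (c n), hc, sub_eq_add_neg, sub_eq_add_neg,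
      add_neg_cancel_comm]
    rw [eval_eq_sum, sum_over_range' _ _ _ (lt_add_of_pos_right _ zero_lt_two), ←
      Finset.sum_range_add_sum_Ico _ (Nat.le_add_left _ _)]
    swap
    · intro i
      rw [zero_mul]
    refine Ideal.add_mem _ ?_ ?_
    · rw [← one_add_one_eq_two, Finset.sum_range_succ, Finset.range_one, Finset.sum_singleton,
        taylor_coeff_zero, taylor_coeff_one, pow_zero, pow_one, mul_one, mul_neg,
        mul_left_comm, Ring.mul_inverse_cancel _ (hf'c n), mul_one, add_neg_cancel]
      exact Ideal.zero_mem _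
    · refine Submodule.sum_mem _ ?_
      simp only [Finset.mem_Ico]
      rintro i ⟨h2i, _⟩
      have aux : n + 2 ≤ i * (n + 1) := by trans 2 * (n + 1) <;> nlinarith only [h2i]
      refine Ideal.mul_mem_left _ _ (Ideal.pow_le_pow_right aux ?_)
      rw [pow_mul']
      exact Ideal.pow_mem_pow ((Ideal.neg_mem_iff _).2 <| Ideal.mul_mem_right _ _ ih) _
  -- the sequence is Cauchy
  have aux : ∀ m n, m ≤ n → c m ≡ c n [SMOD (I ^ m • ⊤ : Ideal R)] := by
    intro m n hmn
    rw [← Ideal.one_eq_top, Ideal.smul_eq_mul, mul_one]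
    obtain ⟨k, rfl⟩ := Nat.exists_eq_add_of_le hmn
    clear hmn
    induction k with
    | zero => rw [add_zero]
    | succ k ih => ?_
    rw [← add_assoc, hc, ← add_zero (c m), sub_eq_add_neg]
    refine ih.add ?_
    symm
    rw [SModEq.zero, Ideal.neg_mem_iff]
    refine Ideal.mul_mem_right _ _ (Ideal.pow_le_pow_right ?_ (hfcI _))
    rw [add_assoc]
    exact le_self_add
  -- its limit is the root
  obtain ⟨a, ha⟩ := IsPrecomplete.prec' c (aux _ _)
  refine ⟨a, ?_, ?_⟩
  · show f.IsRoot a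
    suffices ∀ n, f.eval a ≡ 0 [SMOD (I ^ n • ⊤ : Ideal R)] by exact IsHausdorff.haus' _ this
    intro n
    specialize ha n
    rw [← Ideal.one_eq_top, Ideal.smul_eq_mul, mul_one] at ha ⊢
    refine (ha.symm.eval f).trans ?_
    rw [SModEq.zero]
    exact Ideal.pow_le_pow_right le_self_add (hfcI _)
  · show a - a₀ ∈ I
    specialize ha (0 + 1)
    rw [hc, pow_one, ← Ideal.one_eq_top, Ideal.smul_eq_mul, mul_one, sub_eq_add_neg] at ha
    rw [← SModEq.sub_mem, ← add_zero a₀]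
    refine ha.symm.trans (SModEq.rfl.add ?_)
    rw [SModEq.zero, Ideal.neg_mem_iff]
    exact Ideal.mul_mem_right _ _ h₁

end Newton

/-! ## §2 The strong form: `f(a₀) = f′(a₀)² ε`, `ε ∈ I` ⟹ a root `a₀ + f′(a₀) t` with `t R = ε R` -/

section Strong

variable {R : Type*} [CommRing R]

/-- **The Taylor substitution `f(a₀ + h t) = h² · F(t)`**: with `c := taylor a₀ f`, `q := (c.divX).divX` and `h := f′(a₀)`, if `f(a₀) = h² ε` then for every `t`,
`f(a₀ + h t) = h² · (ε + t + t² · q(h t))`. [cite: Lang2002, Ch. XII §7] -/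
theorem taylor_eval_mul_eq (f : R[X]) (a₀ ε : R) (he : f.eval a₀ = f.derivative.eval a₀ ^ 2 * ε) (t : R) :
    f.eval (a₀ + f.derivative.eval a₀ * t) =
      f.derivative.eval a₀ ^ 2 * (ε + t + t ^ 2 * ((taylor a₀ f).divX.divX).eval (f.derivative.eval a₀ * t)) := by
  set h := f.derivative.eval a₀ with hh
  set c := taylor a₀ f with hcdef
  -- `f(a₀ + y) = c(y)`, `c = c.divX · X + C (f a₀)`, `c.divX = c.divX.divX · X + C h`
  have hc0 : c.coeff 0 = f.eval a₀ := by rw [hcdef, taylor_coeff_zero]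
  have hc1 : c.divX.coeff 0 = h := by rw [coeff_divX, zero_add, hcdef, taylor_coeff_one]
  have hev : f.eval (a₀ + h * t) = c.eval (h * t) := by rw [hcdef, taylor_eval, add_comm]
  have e1 : c.eval (h * t) = c.divX.eval (h * t) * (h * t) + f.eval a₀ := by
    conv_lhs => rw [← divX_mul_X_add c]
    rw [eval_add, eval_mul, eval_X, eval_C, hc0]
  have e2 : c.divX.eval (h * t) = c.divX.divX.eval (h * t) * (h * t) + h := by
    conv_lhs => rw [← divX_mul_X_add c.divX]
    rw [eval_add, eval_mul, eval_X, eval_C, hc1]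
  rw [hev, e1, e2, he]
  ring

/-- **STRONG HENSEL (ideal-theoretic form)**: `R` complete and separated for the `I`-adic topology, `f ∈ R[X]` ANY polynomial, `f(a₀) = f′(a₀)² · ε` with `ε ∈ I` ⟹ there is `t`
with `f(a₀ + f′(a₀)·t) = 0` and `t R = ε R` (`t ∈ (ε)`, `ε ∈ (t)`; in particular `t ∈ I`).  Proof: §1 applied to `F = ε + X + X²·q(hX)` at `0`, and `t(1 + t·q(ht)) = −ε` with
`1 + t·q(ht)` a unit (`I` lies in the Jacobson radical). [cite: NeukirchANT1999, Ch. II §4 (4.6)] [cite: Lang2002, Ch. XII §7 Prop. 7.6] -/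
theorem exists_isRoot_add_mul_of_eval_eq_sq_mul (I : Ideal R) [IsAdicComplete I R] (f : R[X]) (a₀ ε : R) (hε : ε ∈ I)
    (he : f.eval a₀ = f.derivative.eval a₀ ^ 2 * ε) :
    ∃ t : R, f.IsRoot (a₀ + f.derivative.eval a₀ * t) ∧ t ∈ Ideal.span {ε} ∧ ε ∈ Ideal.span {t} := by
  set h := f.derivative.eval a₀ with hh
  set q := (taylor a₀ f).divX.divX with hq
  -- `F(t) = ε + t + t² q(h t)`
  set F : R[X] := C ε + X + X ^ 2 * q.comp (C h * X) with hF
  have hFev : ∀ t, F.eval t = ε + t + t ^ 2 * q.eval (h * t) := by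
    intro t
    simp only [hF, eval_add, eval_C, eval_X, eval_mul, eval_pow, eval_comp]
  have hF0 : F.eval 0 ∈ I := by
    rw [hFev]; simpa using hε
  have hF1 : IsUnit (Ideal.Quotient.mk I (F.derivative.eval 0)) := by
    have hcoeff : F.derivative.eval 0 = 1 := by
      rw [← coeff_zero_eq_eval_zero, coeff_derivative]
      simp only [Nat.cast_zero, zero_add, mul_one, hF, coeff_add, coeff_C, coeff_X_one, coeff_X_pow_mul']
      norm_num
    rw [hcoeff, map_one]
    exact isUnit_one
  obtain ⟨t, htroot, htI⟩ := exists_isRoot_sub_mem_of_isAdicComplete I F 0 hF0 hF1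
  rw [sub_zero] at htI
  have hroot : ε + t + t ^ 2 * q.eval (h * t) = 0 := by rw [← hFev]; exact htroot
  refine ⟨t, ?_, ?_, ?_⟩
  · -- `f(a₀ + h t) = h² F(t) = 0`
    show f.eval (a₀ + h * t) = 0
    rw [hh, taylor_eval_mul_eq f a₀ ε he t, ← hq, ← hh, hroot, mul_zero]
  · -- `t (1 + t q(ht)) = -ε`, `1 + t q(ht)` a unit
    have hu : IsUnit (t * q.eval (h * t) + 1) :=
      Ideal.mem_jacobson_bot.1 (IsAdicComplete.le_jacobson_bot I htI) (q.eval (h * t))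
    obtain ⟨u, hu'⟩ := hu
    refine Ideal.mem_span_singleton'.2 ⟨-(↑u⁻¹ : R), ?_⟩
    have hεt : ε = -(t * (u : R)) := by
      rw [hu']; linear_combination hroot
    rw [hεt]
    calc -(↑u⁻¹ : R) * -(t * ↑u) = t * (↑u * ↑u⁻¹) := by ring
      _ = t := by rw [Units.mul_inv, mul_one]
  · refine Ideal.mem_span_singleton'.2 ⟨-(t * q.eval (h * t) + 1), ?_⟩
    linear_combination (-1 : R) * hroot

end Strong

/-! ## §3 Local fields: `|f(a₀)| < |f′(a₀)|²` ⟹ a root `a` with `|a − a₀| · |f′(a₀)| ≤ |f(a₀)|` -/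

section LocalField

open Literature.NumberTheory.GaloisRepresentations Literature.NumberTheory.GaloisRepresentations.IsNonarchimedeanLocalField
open scoped NNReal ValuativeRel

variable {K : Type*} [Field K] [ValuativeRel K] [TopologicalSpace K] [IsNonarchimedeanLocalField K]

/-- **STRONG HENSEL IN A NON-ARCHIMEDEAN LOCAL FIELD** (`𝒪[K]` is `𝓂`-adically complete, Mathlib): for `f ∈ 𝒪[K][X]` (any degree, no monicity) and `a₀ ∈ 𝒪[K]` with
`|f(a₀)| < |f′(a₀)|²` there is a root `a ∈ 𝒪[K]` with `|a − a₀| · |f′(a₀)| ≤ |f(a₀)|` (`|·| = normAbs K`).  [cite: NeukirchANT1999, Ch. II §4 Lemma (4.6)] -/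
theorem exists_isRoot_of_normAbs_eval_lt_sq (f : 𝒪[K][X]) (a₀ : 𝒪[K])
    (hlt : normAbs K ((f.eval a₀ : 𝒪[K]) : K) < normAbs K ((f.derivative.eval a₀ : 𝒪[K]) : K) ^ 2) :
    ∃ a : 𝒪[K], f.IsRoot a ∧
      normAbs K ((a : K) - (a₀ : K)) * normAbs K ((f.derivative.eval a₀ : 𝒪[K]) : K) ≤ normAbs K ((f.eval a₀ : 𝒪[K]) : K) := by
  letI := IsTopologicalAddGroup.rightUniformSpace K
  haveI := isUniformAddGroup_of_addCommGroup (G := K)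
  set e : 𝒪[K] := f.eval a₀ with hedef
  set h : 𝒪[K] := f.derivative.eval a₀ with hhdef
  have hh0 : (h : K) ≠ 0 := by
    intro h0
    rw [h0, map_zero, zero_pow two_ne_zero] at hlt
    exact absurd hlt (not_lt.2 bot_le)
  have hhpos : 0 < normAbs K (h : K) := pos_iff_ne_zero.2 ((map_ne_zero (normAbs K)).2 hh0)
  -- `ε := e ∕ h²` has `|ε| < 1`, hence lies in `𝓂[K]`
  have hεlt : normAbs K ((e : K) / (h : K) ^ 2) < 1 := by
    rw [map_div₀, map_pow, div_lt_one (pow_pos hhpos 2)]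
    exact hlt
  have hεO : (e : K) / (h : K) ^ 2 ∈ 𝒪[K] := normAbs_le_one_iff.1 hεlt.le
  set ε : 𝒪[K] := ⟨(e : K) / (h : K) ^ 2, hεO⟩ with hεdef
  have hεm : ε ∈ 𝓂[K] := normAbs_lt_one_iff_mem_maximalIdeal.1 (by simpa [hεdef] using hεlt)
  have he : f.eval a₀ = f.derivative.eval a₀ ^ 2 * ε := by
    apply Subtype.ext
    rw [← hedef, ← hhdef]
    show (e : K) = ((h ^ 2 * ε : 𝒪[K]) : K)
    simp only [hεdef, Subring.coe_mul, SubmonoidClass.coe_pow]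
    field_simp
  obtain ⟨t, htroot, htε, -⟩ := exists_isRoot_add_mul_of_eval_eq_sq_mul 𝓂[K] f a₀ ε hεm he
  refine ⟨a₀ + f.derivative.eval a₀ * t, htroot, ?_⟩
  -- `t = r ε` with `r ∈ 𝒪[K]`, so `|t| ≤ |ε|`
  obtain ⟨r, hr⟩ := Ideal.mem_span_singleton'.1 htε
  have htle : normAbs K (t : K) ≤ normAbs K (ε : K) := by
    rw [← hr, Subring.coe_mul, map_mul]
    calc normAbs K (r : K) * normAbs K (ε : K) ≤ 1 * normAbs K (ε : K) := mul_le_mul_of_nonneg_right (normAbs_le_one_iff.2 r.2) bot_le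
      _ = normAbs K (ε : K) := one_mul _
  rw [← hhdef, Subring.coe_add, Subring.coe_mul, add_sub_cancel_left, map_mul]
  calc normAbs K (h : K) * normAbs K (t : K) * normAbs K (h : K)
      ≤ normAbs K (h : K) * normAbs K (ε : K) * normAbs K (h : K) := by gcongr
    _ = normAbs K (e : K) := by
      rw [hεdef]
      show normAbs K (h : K) * normAbs K ((e : K) / (h : K) ^ 2) * normAbs K (h : K) = normAbs K (e : K)
      rw [map_div₀, map_pow]
      field_simp

end LocalField

end Summit.HodgeConjecture.HodgeConjecture.Cruxes.H413.K2E3StrongHensel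

end
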